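import Literature.Topology.FourManifolds.SurfaceGroupHandleMoves
import Literature.GroupTheory.CombinatorialGroupTheory.NielsenTheorem
import HarnessLib

/-!
# Handlebody realisation: automorphisms of `π₁(H_g) = S_g ⧸ ⟪cut system⟫` lift to `Aut S_g`
(Griffiths 1964; Zieschang 1964)

Topic `Literature/Topology/FourManifolds` (vocabulary of `GroupTrisections.lean`,
`SurfaceGroupHandleMoves.lean`; Nielsen's theorem from
`Literature/GroupTheory/CombinatorialGroupTheory/NielsenTheorem.lean`).  For the genus-`g`
surface group `S_g = ⟨a₀,b₀,…,a_{g-1},b_{g-1} ∣ ∏ [aᵢ,bᵢ]⟩` and a CUT SYSTEM `c : Fin g → Bool`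
(kill `aᵢ` if `c i = false`, `bᵢ` if `c i = true`) with kernel `N_c = ⟪of (i, c i)⟫`
(`SurfaceGroup.cutKernel c`; the quotient `S_g ⧸ N_c` is the fundamental group of the genus-`g`
handlebody, free of rank `g`), **every automorphism `θ` of `S_g ⧸ N_c` is induced by an
automorphism `β` of `S_g` with `β(N_c) = N_c`**:
`SurfaceGroup.exists_mulEquiv_map_cutKernel_eq` (`∃ β, N_c.map β = N_c ∧ π ∘ β = θ ∘ π`).

This is the algebraic content of Griffiths' theorem (Abh. Math. Sem. Univ. Hamburg 26 (1964),
main theorem: the homeomorphisms of a handlebody `V` realise exactly the stabiliser of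
`ker (π₁ ∂V → π₁ V)` in the mapping class group of `∂V`) combined with Zieschang's (every
automorphism of `π₁ V = F_g` is induced by a homeomorphism of `V`; Zieschang 1964, Nielsen's
method), read through Dehn–Nielsen–Baer; restated in McCullough–Miller (Mem. AMS 344, §1) and
Hensel's primer on handlebody groups.  Inner automorphisms and the twist group are not needed:
the lift is produced generator by generator.  In terms of `SurfaceGroupEpimorphisms.lean` this is
the EQUAL-KERNEL case of the named fact `GrigorchukKurchanov1990_stronglyEquivalent` (two
epimorphisms `S_g ↠ F_g` with the same cut kernel differ by an automorphism of `S_g`), proved here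
unconditionally.

## Proof (fully formalised, no named facts)

* `inducedAut N ≤ Aut (G ⧸ N)` — automorphisms induced by automorphisms of `G` form a subgroup;
  an inducing automorphism stabilises `N` automatically (`map_eq_of_induced`).
* `aQuotientEquiv : S_g ⧸ ⟪aᵢ⟫ ≃* F_g` (`b̄ᵢ ↦ xᵢ`).  Transported along it, the elementary Nielsen
  automorphisms are induced: `xₖ ↦ xₖ⁻¹` by `flipEquiv k`, `xₖ ↦ xₖ xₗ` by `slideEquiv` (`k < l`)
  or `coslideEquiv` (`l < k`) of `SurfaceGroupHandleMoves.lean` (`flip_mem_inducedAut`,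
  `beta_mem_inducedAut_of_lt/_of_gt`: a check on the `2g` generators, the killed letters `aᵢ` and
  the middle block `mid k l ∈ ⟪aᵢ⟫` dying in the quotient).  By Nielsen's theorem
  (`mem_nielsenSubgroup_fin`) they generate, so `inducedAut ⟪aᵢ⟫ = ⊤`
  (`inducedAut_aKernel_eq_top`).
* A general cut system is the image of `{aᵢ}` under `cutSwapEquiv c` (`map_aKernel_cutSwapEquiv`),
  and the statement is transported along `QuotientGroup.congr`.

## References

* H. B. Griffiths, *Automorphisms of a 3-dimensional handlebody*, Abh. Math. Sem. Univ. Hamburg 26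
  (1964) 191–210, main theorem. [GriffithsHB1964Handlebody]
* H. Zieschang, *Alternierende Produkte in freien Gruppen*, Abh. Math. Sem. Univ. Hamburg 27 (1964)
  13–31. [Zieschang1964]
* R. C. Lyndon, P. E. Schupp, *Combinatorial Group Theory* (2001), Ch. I Prop. 4.1 (Nielsen's
  generators of `Aut F_n`). [LyndonSchupp2001]
-/

noncomputable section

namespace Literature.Topology.FourManifolds

open Subgroup Literature.GroupTheory.CombinatorialGroupTheory

/-! ## Automorphisms of a quotient induced by automorphisms of the group -/

section induced

variable {G : Type*} [Group G] (N : Subgroup G) [N.Normal]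

/-- The subgroup of `Aut (G ⧸ N)` of automorphisms `θ` INDUCED by automorphisms `β` of `G`
(`π ∘ β = θ ∘ π`). [folklore] -/
def inducedAut : Subgroup (MulAut (G ⧸ N)) where
  carrier := {θ | ∃ β : G ≃* G, ∀ x : G, (QuotientGroup.mk (β x) : G ⧸ N) = θ (QuotientGroup.mk x)}
  one_mem' := ⟨MulEquiv.refl G, fun _ => rfl⟩
  mul_mem' := by
    rintro θ₁ θ₂ ⟨β₁, h₁⟩ ⟨β₂, h₂⟩
    exact ⟨β₂.trans β₁, fun x => by rw [MulEquiv.trans_apply, h₁, h₂, MulAut.mul_apply]⟩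
  inv_mem' := by
    rintro θ ⟨β, h⟩
    refine ⟨β.symm, fun x => ?_⟩
    rw [MulAut.inv_apply, MulEquiv.eq_symm_apply, ← h, MulEquiv.apply_symm_apply]

/-- Membership in `inducedAut N`. [folklore] -/
theorem mem_inducedAut {θ : MulAut (G ⧸ N)} :
    θ ∈ inducedAut N ↔
      ∃ β : G ≃* G, ∀ x : G, (QuotientGroup.mk (β x) : G ⧸ N) = θ (QuotientGroup.mk x) :=
  Iff.rfl

/-- An automorphism of `G` inducing an automorphism of `G ⧸ N` stabilises `N`. [folklore] -/
theorem map_eq_of_induced (θ : MulAut (G ⧸ N)) (β : G ≃* G)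
    (h : ∀ x : G, (QuotientGroup.mk (β x) : G ⧸ N) = θ (QuotientGroup.mk x)) :
    N.map β.toMonoidHom = N := by
  have key : ∀ x, β x ∈ N ↔ x ∈ N := fun x => by
    rw [← QuotientGroup.eq_one_iff, ← QuotientGroup.eq_one_iff, h, MulEquiv.map_eq_one_iff]
  ext x
  constructor
  · rintro ⟨y, hy, rfl⟩
    exact (key y).2 hy
  · intro hx
    exact ⟨β.symm x, (key _).1 (by simpa using hx), by simp⟩

/-- Transport: if `T ∈ Aut G` carries `N` onto `N'` and the `T`-conjugate of `θ ∈ Aut (G ⧸ N')` is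
induced, so is `θ`. [folklore] -/
theorem mem_inducedAut_of_map_eq {N' : Subgroup G} [N'.Normal] (T : G ≃* G)
    (hT : N.map (T : G →* G) = N') (θ : MulAut (G ⧸ N'))
    (h : (QuotientGroup.congr N N' T hT).trans (θ.trans (QuotientGroup.congr N N' T hT).symm) ∈
      inducedAut N) :
    θ ∈ inducedAut N' := by
  obtain ⟨β', hβ'⟩ := h
  refine ⟨T.symm.trans (β'.trans T), fun s => ?_⟩
  have hTq_mk : ∀ y, QuotientGroup.congr N N' T hT (QuotientGroup.mk y) = QuotientGroup.mk (T y) :=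
    fun y => QuotientGroup.congr_mk N N' T hT y
  have hTq_symm_mk : ∀ s, (QuotientGroup.congr N N' T hT).symm (QuotientGroup.mk s) =
      QuotientGroup.mk (T.symm s) := fun s =>
    (QuotientGroup.congr N N' T hT).injective (by
      rw [MulEquiv.apply_symm_apply, hTq_mk, MulEquiv.apply_symm_apply])
  rw [MulEquiv.trans_apply, MulEquiv.trans_apply, ← hTq_mk, hβ', ← hTq_symm_mk]
  simp only [MulEquiv.trans_apply, MulEquiv.apply_symm_apply]

end induced

namespace SurfaceGroup

variable {g : ℕ}

/-! ## Cut systems and the handlebody quotient -/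

/-- The kernel of a CUT SYSTEM: the normal closure of one generator per handle, `aᵢ` if
`c i = false` and `bᵢ` if `c i = true` (the kernel of `π₁(Σ_g) → π₁` of the handlebody in
which these curves bound discs). [folklore] -/
def cutKernel (c : Fin g → Bool) : Subgroup (SurfaceGroup g) :=
  normalClosure (Set.range fun i : Fin g => (PresentedGroup.of (i, c i) : SurfaceGroup g))

/-- Cut kernels are normal. [folklore] -/
instance cutKernel_normal (c : Fin g → Bool) : (cutKernel c).Normal := by
  unfold cutKernel; infer_instance

/-- The cut generators lie in the cut kernel. [folklore] -/
theorem of_mem_cutKernel (c : Fin g → Bool) (i : Fin g) :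
    (PresentedGroup.of (i, c i) : SurfaceGroup g) ∈ cutKernel c :=
  subset_normalClosure ⟨i, rfl⟩

variable (g) in
/-- The standard cut system `{a₀, …, a_{g-1}}`: `⟪aᵢ⟫`. [folklore] -/
abbrev aKernel : Subgroup (SurfaceGroup g) := cutKernel fun _ : Fin g => false

/-- `aᵢ ∈ ⟪aᵢ⟫`. [folklore] -/
theorem a_mem_aKernel (i : Fin g) : a i ∈ aKernel g := of_mem_cutKernel _ i

/-- `āᵢ = 1` in `S_g ⧸ ⟪aᵢ⟫`. [folklore] -/
@[simp] theorem mk_a (i : Fin g) : (QuotientGroup.mk (a i) : SurfaceGroup g ⧸ aKernel g) = 1 :=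
  (QuotientGroup.eq_one_iff _).2 (a_mem_aKernel i)

/-- The middle block `mid k l` dies in `S_g ⧸ ⟪aᵢ⟫`. [folklore] -/
@[simp] theorem mk_mid (k l : ℕ) :
    (QuotientGroup.mk (mid k l) : SurfaceGroup g ⧸ aKernel g) = 1 := by
  rw [← QuotientGroup.mk'_apply]
  exact map_mid_eq_one _ k l fun j => Or.inl (by simp)

/-- Killing the `aᵢ`: `S_g →* F_g`, `aᵢ ↦ 1`, `bᵢ ↦ xᵢ`. [folklore] -/
def eraseA : SurfaceGroup g →* FreeGroup (Fin g) :=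
  PresentedGroup.toGroup (f := fun p : surfaceGen g => bif p.2 then FreeGroup.of p.1 else 1) (by
    intro r hr
    rw [Set.mem_singleton_iff] at hr
    subst hr
    exact lift_surfaceRelator_eq_one_of_hits _ fun j => Or.inl rfl)

/-- `eraseA aᵢ = 1`. [folklore] -/
@[simp] theorem eraseA_a (i : Fin g) : eraseA (a i) = 1 := by
  simp [eraseA, a_def]

/-- `eraseA bᵢ = xᵢ`. [folklore] -/
@[simp] theorem eraseA_b (i : Fin g) : eraseA (b i) = FreeGroup.of i := by
  simp [eraseA, b_def]

/-- `⟪aᵢ⟫ ≤ ker eraseA`. [folklore] -/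
theorem aKernel_le_ker_eraseA : aKernel g ≤ (eraseA (g := g)).ker :=
  normalClosure_le_normal (by
    rintro _ ⟨i, rfl⟩
    simp [← a_def])

/-- **`π₁` of the handlebody is free**: `S_g ⧸ ⟪a₀,…,a_{g-1}⟫ ≃* F_g`, `b̄ᵢ ↦ xᵢ`. [folklore] -/
def aQuotientEquiv : SurfaceGroup g ⧸ aKernel g ≃* FreeGroup (Fin g) :=
  MonoidHom.toMulEquiv (QuotientGroup.lift (aKernel g) eraseA aKernel_le_ker_eraseA)
    (FreeGroup.lift fun i => (QuotientGroup.mk (b i) : SurfaceGroup g ⧸ aKernel g))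
    (QuotientGroup.monoidHom_ext _ (PresentedGroup.ext fun p => by
      obtain ⟨i, _ | _⟩ := p
      · simp [← a_def]
      · simp [← b_def]))
    (FreeGroup.ext_hom _ _ fun i => by simp)

/-- `aQuotientEquiv āᵢ = 1`. [folklore] -/
@[simp] theorem aQuotientEquiv_mk_a (i : Fin g) :
    aQuotientEquiv (QuotientGroup.mk (a i) : SurfaceGroup g ⧸ aKernel g) = 1 := by
  simp

/-- `aQuotientEquiv b̄ᵢ = xᵢ`. [folklore] -/
@[simp] theorem aQuotientEquiv_mk_b (i : Fin g) :
    aQuotientEquiv (QuotientGroup.mk (b i) : SurfaceGroup g ⧸ aKernel g) = FreeGroup.of i := by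
  simp [aQuotientEquiv]

/-- `aQuotientEquiv⁻¹ xᵢ = b̄ᵢ`. [folklore] -/
@[simp] theorem aQuotientEquiv_symm_of (i : Fin g) :
    (aQuotientEquiv (g := g)).symm (FreeGroup.of i) = QuotientGroup.mk (b i) := by
  simp [aQuotientEquiv]

/-- `of (i, false) ∈ ⟪aᵢ⟫` (generator form of `a_mem_aKernel`). [folklore] -/
@[simp] theorem of_false_mem_aKernel (i : Fin g) :
    (PresentedGroup.of (i, false) : SurfaceGroup g) ∈ aKernel g :=
  a_mem_aKernel i

/-- Generator form of `mk_a`. [folklore] -/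
@[simp] theorem mk_of_false (i : Fin g) :
    (QuotientGroup.mk (PresentedGroup.of (i, false)) : SurfaceGroup g ⧸ aKernel g) = 1 :=
  mk_a i

/-- Generator form of `aQuotientEquiv_mk_b`. [folklore] -/
@[simp] theorem aQuotientEquiv_mk_of_true (i : Fin g) :
    aQuotientEquiv (QuotientGroup.mk (PresentedGroup.of (i, true)) : SurfaceGroup g ⧸ aKernel g) =
      FreeGroup.of i :=
  aQuotientEquiv_mk_b i

/-! ## Lifting the elementary Nielsen automorphisms -/

/-- An elementary automorphism of `F_g`, transported to `S_g ⧸ ⟪aᵢ⟫`. [folklore] -/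
abbrev transportAut (ε : MulAut (FreeGroup (Fin g))) : MulAut (SurfaceGroup g ⧸ aKernel g) :=
  (MulAut.congr (aQuotientEquiv (g := g))).symm ε

/-- To be induced by `β` it suffices to check the `2g` generators. [folklore] -/
theorem induced_of_gens {θ : MulAut (SurfaceGroup g ⧸ aKernel g)}
    {β : SurfaceGroup g ≃* SurfaceGroup g}
    (ha : ∀ i, (QuotientGroup.mk (β (a i)) : SurfaceGroup g ⧸ aKernel g) = 1)
    (hb : ∀ i, (QuotientGroup.mk (β (b i)) : SurfaceGroup g ⧸ aKernel g) =
      θ (QuotientGroup.mk (b i))) :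
    ∀ x, (QuotientGroup.mk (β x) : SurfaceGroup g ⧸ aKernel g) = θ (QuotientGroup.mk x) := by
  have key : (QuotientGroup.mk' (aKernel g)).comp β.toMonoidHom =
      θ.toMonoidHom.comp (QuotientGroup.mk' (aKernel g)) :=
    PresentedGroup.ext fun p => by
      obtain ⟨i, _ | _⟩ := p
      · simpa [← a_def] using ha i
      · simpa [← b_def] using hb i
  intro x
  exact DFunLike.congr_fun key x

/-- The Nielsen inversion `xₖ ↦ xₖ⁻¹` is induced by `flipEquiv k`. [folklore] -/
theorem flip_mem_inducedAut (k : Fin g) :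
    transportAut (nielsenAlpha k) ∈ inducedAut (aKernel g) := by
  refine ⟨flipEquiv k, induced_of_gens (fun i => ?_) (fun i => ?_)⟩
  · by_cases hi : i = k
    · subst hi; simp [flipEquiv_a_self]
    · simp [flipEquiv_a_of_ne hi]
  · by_cases hi : i = k
    · subst hi
      simp [flipEquiv_b_self]
    · simp [flipEquiv_b_of_ne hi, nielsenAlpha_of_ne hi]

/-- The Nielsen transvection `xₖ ↦ xₖ xₗ` for `k < l` is induced by `slideEquiv`. [folklore] -/
theorem beta_mem_inducedAut_of_lt {k l : Fin g} (hkl : k < l) :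
    transportAut (nielsenBeta k l hkl.ne) ∈ inducedAut (aKernel g) := by
  refine ⟨slideEquiv hkl, induced_of_gens (fun i => ?_) (fun i => ?_)⟩
  · by_cases hik : i = k
    · subst hik
      simp [a_def i, slideEquiv_of, HandleWords.slideA]
    by_cases hil : i = l
    · subst hil
      simp [a_def i, slideEquiv_of, hkl, HandleWords.slideC]
    · simp [a_def i, slideEquiv_of, blockGens_of_ne _ _ _ _ hik hil]
  · by_cases hik : i = k
    · subst hik
      simp [b_def i, slideEquiv_of, HandleWords.slideB, nielsenBeta_of_self hkl.ne]
    by_cases hil : i = l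
    · subst hil
      simp [b_def i, slideEquiv_of, hkl, HandleWords.slideD,
        nielsenBeta_of_ne hkl.ne hkl.ne']
    · simp [b_def i, slideEquiv_of, blockGens_of_ne _ _ _ _ hik hil,
        nielsenBeta_of_ne hkl.ne hik]

/-- The Nielsen transvection `xₖ ↦ xₖ xₗ` for `l < k` is induced by `coslideEquiv`. [folklore] -/
theorem beta_mem_inducedAut_of_gt {k l : Fin g} (hlk : l < k) :
    transportAut (nielsenBeta k l hlk.ne') ∈ inducedAut (aKernel g) := by
  refine ⟨coslideEquiv hlk, induced_of_gens (fun i => ?_) (fun i => ?_)⟩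
  · by_cases hil : i = l
    · subst hil
      simp [a_def i, coslideEquiv_of, HandleWords.coslideA]
    by_cases hik : i = k
    · subst hik
      simp [a_def i, coslideEquiv_of, hlk, HandleWords.coslideC]
    · simp [a_def i, coslideEquiv_of, blockGens_of_ne _ _ _ _ hil hik]
  · by_cases hil : i = l
    · subst hil
      simp [b_def i, coslideEquiv_of, HandleWords.coslideB,
        nielsenBeta_of_ne hlk.ne' hlk.ne]
    by_cases hik : i = k
    · subst hik
      simp [b_def i, coslideEquiv_of, hlk, HandleWords.coslideD,
        nielsenBeta_of_self hlk.ne']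
    · simp [b_def i, coslideEquiv_of, blockGens_of_ne _ _ _ _ hil hik,
        nielsenBeta_of_ne hlk.ne' hik]

/-- Every elementary Nielsen automorphism, transported to `S_g ⧸ ⟪aᵢ⟫`, is induced. [folklore] -/
theorem mem_inducedAut_of_mem_elementaryNielsen {ε : MulAut (FreeGroup (Fin g))}
    (hε : ε ∈ elementaryNielsen (Fin g)) : transportAut ε ∈ inducedAut (aKernel g) := by
  rcases hε with ⟨k, rfl⟩ | ⟨k, l, hkl, rfl⟩
  · exact flip_mem_inducedAut k
  · rcases lt_or_gt_of_ne hkl with h | h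
    · exact beta_mem_inducedAut_of_lt h
    · exact beta_mem_inducedAut_of_gt h

/-- **Every automorphism of `S_g ⧸ ⟪a₀,…,a_{g-1}⟫` is induced by an automorphism of `S_g`**
(Nielsen's theorem + the lifts of the elementary automorphisms).
[cite: GriffithsHB1964Handlebody, main theorem] -/
theorem inducedAut_aKernel_eq_top : inducedAut (aKernel g) = ⊤ := by
  rw [eq_top_iff]
  intro θ _
  have hmem : MulAut.congr (aQuotientEquiv (g := g)) θ ∈ nielsenSubgroup (Fin g) :=
    mem_nielsenSubgroup_fin _
  have hle : nielsenSubgroup (Fin g) ≤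
      (inducedAut (aKernel g)).map (MulAut.congr (aQuotientEquiv (g := g))).toMonoidHom := by
    unfold nielsenSubgroup
    rw [Subgroup.closure_le]
    intro ε hε
    exact ⟨transportAut ε, mem_inducedAut_of_mem_elementaryNielsen hε,
      MulEquiv.apply_symm_apply _ ε⟩
  obtain ⟨θ', hθ', h⟩ := hle hmem
  have : θ' = θ := (MulAut.congr (aQuotientEquiv (g := g))).injective h
  rwa [← this]

/-! ## General cut systems -/

/-- `cutSwapEquiv c` carries `⟪aᵢ⟫` onto the cut kernel of `c`. [folklore] -/
theorem map_aKernel_cutSwapEquiv (c : Fin g → Bool) :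
    (aKernel g).map (cutSwapEquiv c : SurfaceGroup g →* SurfaceGroup g) = cutKernel c := by
  rw [aKernel, cutKernel, map_normalClosure _ (cutSwapEquiv c : SurfaceGroup g →* SurfaceGroup g)
    fun x => ⟨(cutSwapEquiv c).symm x, (cutSwapEquiv c).apply_symm_apply x⟩]
  apply le_antisymm
  · refine normalClosure_le_normal ?_
    rintro _ ⟨_, ⟨i, rfl⟩, rfl⟩
    show cutSwapEquiv c (PresentedGroup.of (i, false)) ∈ cutKernel c
    rw [← a_def, cutSwapEquiv_a]
    split_ifs with hc
    · have hb : b i ∈ cutKernel c := by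
        have := of_mem_cutKernel c i
        rwa [hc] at this
      exact (cutKernel_normal c).conj_mem _ hb (a i)
    · have := of_mem_cutKernel c i
      rw [Bool.not_eq_true] at hc
      rwa [hc, ← a_def] at this
  · refine normalClosure_le_normal ?_
    rintro _ ⟨i, rfl⟩
    have hmem : cutSwapEquiv c (a i) ∈
        normalClosure (⇑(cutSwapEquiv c : SurfaceGroup g →* SurfaceGroup g) ''
          Set.range fun i : Fin g => (PresentedGroup.of (i, false) : SurfaceGroup g)) :=
      subset_normalClosure ⟨_, ⟨i, rfl⟩, rfl⟩
    rw [cutSwapEquiv_a] at hmem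
    show PresentedGroup.of (i, c i) ∈ normalClosure _
    cases hc : c i
    · rw [hc] at hmem
      simpa [← a_def] using hmem
    · rw [hc, if_pos rfl] at hmem
      have := normalClosure_normal.conj_mem _ hmem (a i)⁻¹
      rw [← b_def]
      convert this using 1
      group

/-- **Handlebody realisation (Griffiths 1964; Zieschang 1964).** For every cut system `c` of
the genus-`g` surface group (`N = ⟪one of aᵢ, bᵢ per handle⟫`, so that `S_g ⧸ N = π₁` of a
handlebody, free of rank `g`), every automorphism `θ` of `S_g ⧸ N` is induced by an automorphism
`β` of `S_g` stabilising `N`: `β(N) = N` and `π ∘ β = θ ∘ π`.  (Printed form: the homeomorphisms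
of a handlebody `V` induce on `π₁ ∂V` exactly the stabiliser of `ker (π₁ ∂V → π₁ V)`, and every
automorphism of `π₁ V` is induced by a homeomorphism of `V`.)
[cite: GriffithsHB1964Handlebody, main theorem] -/
theorem exists_mulEquiv_map_cutKernel_eq (c : Fin g → Bool) (N : Subgroup (SurfaceGroup g))
    [N.Normal] (hN : N = cutKernel c) (θ : (SurfaceGroup g ⧸ N) ≃* (SurfaceGroup g ⧸ N)) :
    ∃ β : SurfaceGroup g ≃* SurfaceGroup g, N.map β.toMonoidHom = N ∧
      ∀ s, QuotientGroup.mk' N (β s) = θ (QuotientGroup.mk' N s) := by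
  subst hN
  obtain ⟨β, hβ⟩ := mem_inducedAut_of_map_eq (aKernel g) (cutSwapEquiv c)
    (map_aKernel_cutSwapEquiv c) θ (by rw [inducedAut_aKernel_eq_top]; exact Subgroup.mem_top _)
  exact ⟨β, map_eq_of_induced _ θ β hβ, fun s => by simpa using hβ s⟩

end SurfaceGroup

end Literature.Topology.FourManifolds

end
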